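import Summits.BirchSwinnertonDyer.BirchSwinnertonDyer.Theorems.ResidualThetaTransportAtTwoResidualSignedLambdaLowerCMAtTwoRhoLayerPairingCompat
import Literature.NumberTheory.EllipticCurves.GreenbergSelmerCofreeUnramifiedFinite
import Literature.NumberTheory.EllipticCurves.GreenbergSelmerCofreeReductionSeparated
import Literature.NumberTheory.EllipticCurves.Kato2004.UniversalNormsLayers
import Literature.NumberTheory.EllipticCurves.SelmerGroupOverTorsionFinite
import Literature.NumberTheory.EllipticCurves.ZpExtensionUnramifiedProofs
import HarnessLib

/-!
# The ADMISSIBLE SETS «classes of `H¹(Γ_n, A_ρ[p^k])` dying on every `Γ_n ⊓ I_𝔓`, `𝔓 ∣ v ∉ S ∋ p`» for a framed representation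
# `ρ : Γ_ℚ → GL_d(𝒪)`: stable under the trace maps `Cor`, stable under `[p]_*`, FINITE for compact `𝒪`; and a `T_ρ`-adic class all of
# whose reductions die on `U ⊓ I_𝔓` dies there — the `ρ`-coefficient twin of `…SignedMainConjectureCMTwoRankZeroPTDeepAdmissible.lean`

Route `ResidualThetaTransportAtTwo` (RTT), crux RSL_g `ResidualSignedLambdaLowerCMAtTwo` (stmt-BirchSwinnertonDyer-22608); seat
`prover-bsd-wall-tp2-p2x` g17 (`--supports 22608 --as helper`, closes nothing). THEOREMS ONLY (no definition, no named fact, no instance,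
no `sorry`). Stub plan rev 14/15 S56: the deep-half stubs `stub_deepHalfAwayTwo` / `stub_deepHalfAtTwoStrict` of `Lines/onepair.lean` feed
`ThetaTransport.exists_iwasawaH1_of_levelwise` (file `…CofreeLimitFamily.lean`) with levelwise solution sets
`Sol n k ⊆ H¹(Γ_n, A_ρ[p^k])` that must be FINITE (`hfin`) and stable under `[p]_*` (`hSk`) and `Cor` (`hSn`); the part of these three
obligations that does not depend on the pinned pairings is the bookkeeping of the UNRAMIFIED-OUTSIDE-`S` condition, done here once in Kato's
dialect `resLe … (Γ_n ⊓ I_𝔓 ≤ Γ_n) 1 c = 0` (the shape of `Kato2004.integralH1` / `IwasawaH1DataCoeff.proj_mem`), for the discrete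
Galois module `A_ρ[N]` (`GreenbergSelmer.cofreeTorsionGaloisModule S ρ N`), `N = p^k`:

* §1 `admissible_layerCores` — Cor-stability along ANY `ℤ_p`-extension `κ` of `ℚ` for `p ∈ S` (the layers are unramified outside `p`,
  `ZpExtension.inertia_le_kerSubgroup_holds`; per-place Cor lemma `UniversalNorms.resLe_coresLe_eq_zero_of_forall_primesAbove`).
* §2 `resLe_cohomologyMap_subgroupRepMap` (GENERIC: `H¹(f)` commutes with restriction), `resLe_cohomologyMap_cofreeTorsionPow`,
  `admissible_cofreeTorsionPow` — `[p]_*`-stability.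
* §3 `resLe_inf_eq_zero_iff_resOfLe_inf_eq_zero` — Kato's `resLe` on `H ⊓ I` and Silverman/Greenberg–Vatsal's `resOfLe` on `I ⊓ H` vanish
  together on `H¹(H, A_ρ[N])`; `admissible_of_mem_unramifiedOutside` — a Greenberg–Vatsal class `∈ unramifiedOutside H A_ρ[N] p S₀` is
  admissible for `S = S₀ ∪ {v ∣ p}` (w3's `GreenbergVatsal2000.resOfLe_inertia_inf_eq_zero_of_mem_unramifiedOutside`).
* §4 `admissible_finite` — FINITENESS for finite `S`, `𝒪` compact, `H` open (Silverman X.4.3 at level `H`: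
  `finite_setOf_resOfLe_inertia_inf_eq_zero`, `A_ρ[p^k]` finite by `UniversalNorms.finite_cofreeTorsionBy_of_compactSpace`).
* §5 `reduceH1CofreePkTorsion_resLe`, `resLe_inertia_eq_zero_of_forall_reduceH1CofreePkTorsion` — `red_{p^k}` commutes with restriction,
  and a class of `H¹(U, T_ρ)` all of whose reductions die on `U ⊓ I` dies on `U ⊓ I` (separatedness
  `GreenbergSelmer.eq_zero_of_forall_reduceH1CofreePkTorsion_eq_zero` on `U ⊓ I`).

References: J. H. Silverman, AEC (2009), Lemma X.4.3 [SilvermanAEC2009]; K. Kato, Astérisque 295 (2004), §8.2, Lemma 8.5 (pp. 180–184),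
§12.2 (p. 220), §13.8 (p. 228) [Kato2004Asterisque]; NSW (2008) I §5 (1.5.7) [NeukirchSchmidtWingberg2008]; L. Washington, *Cyclotomic
Fields* (1997), Prop. 13.2 [Washington1997]; K. Rubin, *Euler Systems* (2000), App. B Prop. B.2.3 [Rubin2000]; R. Greenberg, V. Vatsal,
Invent. math. 142 (2000), §2 [GreenbergVatsal2000]. BSD is not proved by any of this; RSL_g (22608) is not proved here.
-/

set_option autoImplicit false
-- the Theorems namespace of this sub repeats the summit name by design (D-0017 nested layout)
set_option linter.dupNamespace false

noncomputable section

open scoped Classical NumberField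

namespace Summit.BirchSwinnertonDyer.BirchSwinnertonDyer.Theorems.ThetaTransport

open CategoryTheory Field IsDedekindDomain
  Literature.NumberTheory.EllipticCurves Literature.NumberTheory.GaloisRepresentations
  Literature.NumberTheory.EllipticCurves.GreenbergSelmer Literature.NumberTheory.EllipticCurves.Kato2004
  ZpExtension

variable {p : ℕ} [Fact p.Prime] (S : Set (PadicAlgCl p)) {d : ℕ} (ρ : FramedGaloisRep ℚ ↥(padicCoeffIntegers S) d)

/-! ## §1 Stability under the trace maps `Cor` -/

/-- **Stability of the admissible sets under the trace maps** `Cor : H¹(Γ_{n+1}, A_ρ[N]) → H¹(Γ_n, A_ρ[N])` (`Kato2004.layerCores`):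
a class dying on every `Γ_{n+1} ⊓ I_𝔓`, `𝔓 ∣ v ∉ S`, has trace dying on every `Γ_n ⊓ I_𝔓`, `𝔓 ∣ v ∉ S` — provided `S` contains the
places above `p` (the layers of a `ℤ_p`-extension are unramified outside `p`: `I_𝔓 ≤ ker κ ≤ Γ_{n+1}`, Washington 13.2; then the per-place
Cor lemma `UniversalNorms.resLe_coresLe_eq_zero_of_forall_primesAbove`, NSW (1.5.7) in the normal case).
[cite: Kato2004Asterisque, §8.2 (p. 181) and §12.2 (p. 220)] [cite: NeukirchSchmidtWingberg2008, I §5 (1.5.7)] [cite: Washington1997, Prop. 13.2] -/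
theorem admissible_layerCores (N : ℤ) (κ : ZpExtension ℚ p) {S' : Set (HeightOneSpectrum (𝓞 ℚ))}
    (hS : ∀ v : HeightOneSpectrum (𝓞 ℚ), (p : 𝓞 ℚ) ∈ v.asIdeal → v ∈ S') (n : ℕ)
    {c : H1 (cofreeTorsionGaloisModule S ρ N) (κ.layerSubgroup (n + 1))}
    (hc : ∀ v ∉ S', ∀ 𝔓 ∈ v.primesAbove,
      resLe (cofreeTorsionGaloisModule S ρ N).toTopRep
        (inf_le_left : κ.layerSubgroup (n + 1) ⊓ 𝔓.inertia (absoluteGaloisGroup ℚ) ≤ κ.layerSubgroup (n + 1)) 1 c = 0) :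
    ∀ v ∉ S', ∀ 𝔓 ∈ v.primesAbove,
      resLe (cofreeTorsionGaloisModule S ρ N).toTopRep
        (inf_le_left : κ.layerSubgroup n ⊓ 𝔓.inertia (absoluteGaloisGroup ℚ) ≤ κ.layerSubgroup n) 1
        (layerCores (cofreeTorsionGaloisModule S ρ N) κ n c) = 0 := by
  intro v hv 𝔓 h𝔓
  have hpv : (p : 𝓞 ℚ) ∉ v.asIdeal := fun h ↦ hv (hS v h)
  haveI : CompactSpace (absoluteGaloisGroup ℚ) := absoluteGaloisGroup_compactSpace ℚ
  haveI : (κ.layerSubgroup (n + 1)).FiniteIndex := finiteIndex_of_isOpen_of_compactSpace _ (κ.isOpen_layerSubgroup (n + 1))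
  letI : Fintype (κ.layerSubgroup n ⧸ (κ.layerSubgroup (n + 1)).subgroupOf (κ.layerSubgroup n)) := Fintype.ofFinite _
  unfold layerCores
  exact UniversalNorms.resLe_coresLe_eq_zero_of_forall_primesAbove (cofreeTorsionGaloisModule S ρ N)
    (κ.layerSubgroup_antitone (Nat.le_succ n)) (κ.isOpen_layerSubgroup (n + 1))
    (fun 𝔓' h𝔓' g _ hg ↦ κ.kerSubgroup_le_layerSubgroup (n + 1) (inertia_le_kerSubgroup_holds ℚ p κ hpv h𝔓' hg))
    (hc v hv) h𝔓

/-! ## §2 Stability under `[p]_*` -/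

/-- **`H¹(f)` commutes with restriction** (GENERIC): for a morphism `f : X ⟶ Y` of topological `G`-modules and subgroups `U ≤ U'`,
`res_{U'→U} ∘ H¹(f|_{U'}) = H¹(f|_U) ∘ res_{U'→U}` on `H¹` — both are `[φ] ↦ [f ∘ φ|_U]` on cocycles (the compatible pairs
`(U ↪ U', f)` compose either way; twin of the tree's `mapH1AddHom_resLe` for Mathlib's `ContinuousCohomology.map`).
[cite: SerreGaloisCohomology1997, I §2.4] -/
theorem resLe_cohomologyMap_subgroupRepMap {R : Type*} [CommRing R] [TopologicalSpace R] {G : Type} [Group G]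
    [TopologicalSpace G] [IsTopologicalGroup G] {X Y : TopRep.{0} R G} (f : X ⟶ Y) {U U' : Subgroup G} (h : U ≤ U')
    (c : continuousCohomology 1 (subgroupRep X U')) :
    resLe Y h 1 (cohomologyMap (subgroupRepMap f U') 1 c) = cohomologyMap (subgroupRepMap f U) 1 (resLe X h 1 c) := by
  obtain ⟨φ, rfl⟩ := oneCocycleClass_surjective _ c
  rw [cohomologyMap_oneCocycleClass, resLe_oneCocycleClass, resLe_oneCocycleClass, cohomologyMap_oneCocycleClass]
  exact congrArg _ (Subtype.ext (ContinuousMap.ext fun g ↦ rfl))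

/-- **`[p]_*` commutes with restriction** `res : H¹(U', A_ρ[p^{k+1}]) → H¹(U, ·)`, `U ≤ U'` (both are `[φ] ↦ [p ∘ φ|_U]` on cocycles).
[cite: SerreGaloisCohomology1997, I §2.4] [cite: Kato2004Asterisque, §13.8 (p. 228)] -/
theorem resLe_cohomologyMap_cofreeTorsionPow (k : ℕ) {U U' : Subgroup (absoluteGaloisGroup ℚ)} (h : U ≤ U')
    (c : H1 (cofreeTorsionGaloisModule S ρ ((p ^ (k + 1) : ℕ) : ℤ)) U') :
    resLe (cofreeTorsionGaloisModule S ρ ((p ^ k : ℕ) : ℤ)).toTopRep h 1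
        (cohomologyMap (subgroupRepMap (cofreeTorsionPow S ρ k) U') 1 c) =
      cohomologyMap (subgroupRepMap (cofreeTorsionPow S ρ k) U) 1
        (resLe (cofreeTorsionGaloisModule S ρ ((p ^ (k + 1) : ℕ) : ℤ)).toTopRep h 1 c) :=
  resLe_cohomologyMap_subgroupRepMap (cofreeTorsionPow S ρ k) h c

/-- **Stability of the admissible sets under `[p]_* : H¹(U, A_ρ[p^{k+1}]) → H¹(U, A_ρ[p^k])`.** [cite: Kato2004Asterisque, §13.8 (p. 228)]
[cite: SerreGaloisCohomology1997, I §2.4] -/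
theorem admissible_cofreeTorsionPow (k : ℕ) {S' : Set (HeightOneSpectrum (𝓞 ℚ))} (U : Subgroup (absoluteGaloisGroup ℚ))
    {c : H1 (cofreeTorsionGaloisModule S ρ ((p ^ (k + 1) : ℕ) : ℤ)) U}
    (hc : ∀ v ∉ S', ∀ 𝔓 ∈ v.primesAbove,
      resLe (cofreeTorsionGaloisModule S ρ ((p ^ (k + 1) : ℕ) : ℤ)).toTopRep
        (inf_le_left : U ⊓ 𝔓.inertia (absoluteGaloisGroup ℚ) ≤ U) 1 c = 0) :
    ∀ v ∉ S', ∀ 𝔓 ∈ v.primesAbove,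
      resLe (cofreeTorsionGaloisModule S ρ ((p ^ k : ℕ) : ℤ)).toTopRep (inf_le_left : U ⊓ 𝔓.inertia (absoluteGaloisGroup ℚ) ≤ U) 1
        (cohomologyMap (subgroupRepMap (cofreeTorsionPow S ρ k) U) 1 c) = 0 := by
  intro v hv 𝔓 h𝔓
  rw [resLe_cohomologyMap_cofreeTorsionPow, hc v hv 𝔓 h𝔓, map_zero]

/-! ## §3 The two dialects of «unramified at `𝔓`» on `H¹(H, A_ρ[N])` -/

/-- `resLe` on `H ⊓ I` (Kato's dialect, `subgroupRep (cofreeTorsionGaloisModule …).toTopRep`) and `resOfLe` on `I ⊓ H` (Silverman /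
Greenberg–Vatsal dialect, `discreteTopRep H A_ρ[N]`) vanish together: both say the cocycle is principal on `H ∩ I` (the two `TopRep`s
agree definitionally, `CyclotomicLayer.discreteTopRep_cofreeTorsionBy_eq`). [cite: SerreGaloisCohomology1997, I §5.1] -/
theorem resLe_inf_eq_zero_iff_resOfLe_inf_eq_zero (N : ℤ) (H I : Subgroup (absoluteGaloisGroup ℚ))
    (c : H1 (cofreeTorsionGaloisModule S ρ N) H) :
    resLe (cofreeTorsionGaloisModule S ρ N).toTopRep (inf_le_left : H ⊓ I ≤ H) 1 c = 0 ↔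
      resOfLe ↥(AddSubgroup.torsionBy (Cofree ρ ↥(padicCoeffField S)) N) (inf_le_right : I ⊓ H ≤ H)
        (c : subgroupH1 H ↥(AddSubgroup.torsionBy (Cofree ρ ↥(padicCoeffField S)) N)) = 0 := by
  obtain ⟨φ, rfl⟩ := oneCocycleClass_surjective (subgroupRep (cofreeTorsionGaloisModule S ρ N).toTopRep H) c
  rw [resLe_oneCocycleClass, oneCocycleClass_eq_zero_iff]
  have h2 := resOfLe_oneCocycleClass_eq_zero_iff H (M := ↥(AddSubgroup.torsionBy (Cofree ρ ↥(padicCoeffField S)) N))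
    (inf_le_right : I ⊓ H ≤ H) φ
  change _ ↔ resOfLe ↥(AddSubgroup.torsionBy (Cofree ρ ↥(padicCoeffField S)) N) (inf_le_right : I ⊓ H ≤ H)
    (oneCocycleClass (discreteTopRep H ↥(AddSubgroup.torsionBy (Cofree ρ ↥(padicCoeffField S)) N)) φ) = 0
  rw [h2]
  constructor
  · rintro ⟨a, ha⟩
    exact ⟨a, fun σ ↦ ha ⟨σ.1, σ.2.2, σ.2.1⟩⟩
  · rintro ⟨a, ha⟩
    exact ⟨a, fun σ ↦ ha ⟨σ.1, σ.2.2, σ.2.1⟩⟩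

/-- **Greenberg–Vatsal ⟹ Kato**: a class of `H¹(H, A_ρ[N])` in `GreenbergVatsal2000.unramifiedOutside H A_ρ[N] p S₀` is admissible for every
`S ⊇ S₀ ∪ {v ∣ p}`: it dies on `H ⊓ I_𝔓` for every `𝔓 ∣ v ∉ S` (w3's all-primes form `resOfLe_inertia_inf_eq_zero_of_mem_unramifiedOutside`
read through §3). [cite: GreenbergVatsal2000, §2 pp. 16, 23] [cite: Kato2004Asterisque, §8.2 (p. 181)] -/
theorem admissible_of_mem_unramifiedOutside (N : ℤ) (H : Subgroup (absoluteGaloisGroup ℚ)) [H.Normal]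
    {S₀ S' : Set (HeightOneSpectrum (𝓞 ℚ))} (hS₀ : S₀ ⊆ S') (hS : ∀ v : HeightOneSpectrum (𝓞 ℚ), (p : 𝓞 ℚ) ∈ v.asIdeal → v ∈ S')
    {c : H1 (cofreeTorsionGaloisModule S ρ N) H}
    (hc : (c : subgroupH1 H ↥(AddSubgroup.torsionBy (Cofree ρ ↥(padicCoeffField S)) N)) ∈
      GreenbergVatsal2000.unramifiedOutside H ↥(AddSubgroup.torsionBy (Cofree ρ ↥(padicCoeffField S)) N) p S₀) :
    ∀ v ∉ S', ∀ 𝔓 ∈ v.primesAbove,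
      resLe (cofreeTorsionGaloisModule S ρ N).toTopRep (inf_le_left : H ⊓ 𝔓.inertia (absoluteGaloisGroup ℚ) ≤ H) 1 c = 0 := by
  intro v hv 𝔓 h𝔓
  rw [resLe_inf_eq_zero_iff_resOfLe_inf_eq_zero]
  exact GreenbergVatsal2000.resOfLe_inertia_inf_eq_zero_of_mem_unramifiedOutside hc (fun h ↦ hv (hS₀ h))
    (fun h ↦ hv (hS v h)) h𝔓

/-! ## §4 Finiteness (Silverman X.4.3 at level `H`) -/

/-- **The admissible sets are FINITE** for finite `S`, compact `𝒪` and open `H`: the classes of `H¹(H, A_ρ[p^k])` dying on every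
`H ⊓ I_𝔓`, `𝔓 ∣ v ∉ S`, form a finite set — Silverman X.4.3 at the open level `H` (`finite_setOf_resOfLe_inertia_inf_eq_zero`) for the
FINITE module `A_ρ[p^k]` (`UniversalNorms.finite_cofreeTorsionBy_of_compactSpace`, continuity `GreenbergSelmer.continuousSMul_cofreeTorsionBy`),
read through §3. [cite: SilvermanAEC2009, Lemma X.4.3 and Prop. VIII.1.6] -/
theorem admissible_finite [CompactSpace ↥(padicCoeffIntegers S)] (k : ℕ) {S' : Set (HeightOneSpectrum (𝓞 ℚ))} (hS : S'.Finite)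
    (H : Subgroup (absoluteGaloisGroup ℚ)) (hH : IsOpen (H : Set (absoluteGaloisGroup ℚ))) :
    {c : H1 (cofreeTorsionGaloisModule S ρ ((p ^ k : ℕ) : ℤ)) H | ∀ v ∉ S', ∀ 𝔓 ∈ v.primesAbove,
      resLe (cofreeTorsionGaloisModule S ρ ((p ^ k : ℕ) : ℤ)).toTopRep
        (inf_le_left : H ⊓ 𝔓.inertia (absoluteGaloisGroup ℚ) ≤ H) 1 c = 0}.Finite := by
  haveI := UniversalNorms.finite_cofreeTorsionBy_of_compactSpace S ρ k
  haveI := continuousSMul_cofreeTorsionBy S ρ ((p ^ k : ℕ) : ℤ)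
  refine (finite_setOf_resOfLe_inertia_inf_eq_zero H
    (M := ↥(AddSubgroup.torsionBy (Cofree ρ ↥(padicCoeffField S)) ((p ^ k : ℕ) : ℤ))) hH hS).subset fun c hc v hv 𝔓 h𝔓 ↦ ?_
  exact (resLe_inf_eq_zero_iff_resOfLe_inf_eq_zero S ρ _ H _ c).mp (hc v hv 𝔓 h𝔓)

/-- The admissible sets at the layers `Γ_n` of a `ℤ_p`-extension are finite (`S` finite, `𝒪` compact). [cite: SilvermanAEC2009, Lemma X.4.3] -/
theorem admissible_finite_layer [CompactSpace ↥(padicCoeffIntegers S)] (κ : ZpExtension ℚ p) (k : ℕ)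
    {S' : Set (HeightOneSpectrum (𝓞 ℚ))} (hS : S'.Finite) (n : ℕ) :
    {c : H1 (cofreeTorsionGaloisModule S ρ ((p ^ k : ℕ) : ℤ)) (κ.layerSubgroup n) | ∀ v ∉ S', ∀ 𝔓 ∈ v.primesAbove,
      resLe (cofreeTorsionGaloisModule S ρ ((p ^ k : ℕ) : ℤ)).toTopRep
        (inf_le_left : κ.layerSubgroup n ⊓ 𝔓.inertia (absoluteGaloisGroup ℚ) ≤ κ.layerSubgroup n) 1 c = 0}.Finite :=
  admissible_finite S ρ k hS (κ.layerSubgroup n) (κ.isOpen_layerSubgroup n)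

/-! ## §5 `T_ρ`-adic classes: unramifiedness is read on the reductions -/

/-- **`red_{p^k}` commutes with restriction** `res : H¹(U', ·) → H¹(U, ·)`, `U ≤ U'`, for the reduction `T_ρ → A_ρ[p^k]`
(`mapH1AddHom_resLe`), read in the `H1 (cofreeTorsionGaloisModule …)` dialect. [cite: Kato2004Asterisque, §13.8 (p. 228)]
[cite: SerreGaloisCohomology1997, I §2.4] -/
theorem reduceH1CofreePkTorsion_resLe (k : ℕ) {U U' : Subgroup (absoluteGaloisGroup ℚ)} (h : U ≤ U')
    (c : H1 (FramedGaloisRep.toGaloisRep ρ) U') :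
    (reduceH1CofreePkTorsion S ρ k U (resLe (FramedGaloisRep.toGaloisRep ρ).toTopRep h 1 c) :
        H1 (cofreeTorsionGaloisModule S ρ ((p ^ k : ℕ) : ℤ)) U) =
      resLe (cofreeTorsionGaloisModule S ρ ((p ^ k : ℕ) : ℤ)).toTopRep h 1
        (reduceH1CofreePkTorsion S ρ k U' c : H1 (cofreeTorsionGaloisModule S ρ ((p ^ k : ℕ) : ℤ)) U') :=
  mapH1AddHom_resLe (X := (FramedGaloisRep.toGaloisRep ρ).toTopRep) (Y := (cofreeTorsionGaloisModule S ρ ((p ^ k : ℕ) : ℤ)).toTopRep)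
    (divPowCofreeMkTorsion S ρ k) (continuous_divPowCofreeMkTorsion S ρ k) h
    (divPowCofreeMkTorsion_subgroupRep S ρ k U) (divPowCofreeMkTorsion_subgroupRep S ρ k U') c

/-- **Unramifiedness at `𝔓` is read on the reductions** (`𝒪` compact): `y ∈ H¹(U, T_ρ)` with `red_{p^k} y` dying on `U ⊓ I` for every
`k` dies on `U ⊓ I` (`reduceH1CofreePkTorsion_resLe` and the separatedness of `H¹(U ⊓ I, T_ρ)` along the reductions,
`GreenbergSelmer.eq_zero_of_forall_reduceH1CofreePkTorsion_eq_zero`). [cite: Rubin2000, App. B Prop. B.2.3] [cite: Kato2004Asterisque, §8.2 (p. 180)] -/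
theorem resLe_inertia_eq_zero_of_forall_reduceH1CofreePkTorsion [CompactSpace ↥(padicCoeffIntegers S)]
    (U I : Subgroup (absoluteGaloisGroup ℚ)) (y : H1 (FramedGaloisRep.toGaloisRep ρ) U)
    (hy : ∀ k : ℕ, resLe (cofreeTorsionGaloisModule S ρ ((p ^ k : ℕ) : ℤ)).toTopRep (inf_le_left : U ⊓ I ≤ U) 1
      (reduceH1CofreePkTorsion S ρ k U y : H1 (cofreeTorsionGaloisModule S ρ ((p ^ k : ℕ) : ℤ)) U) = 0) :
    resLe (FramedGaloisRep.toGaloisRep ρ).toTopRep (inf_le_left : U ⊓ I ≤ U) 1 y = 0 := by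
  refine eq_zero_of_forall_reduceH1CofreePkTorsion_eq_zero S ρ _ _ fun k ↦ ?_
  exact (reduceH1CofreePkTorsion_resLe S ρ k (inf_le_left : U ⊓ I ≤ U) y).trans (hy k)

end Summit.BirchSwinnertonDyer.BirchSwinnertonDyer.Theorems.ThetaTransport

end
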